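import Summits.NavierStokesRegularity.NavierStokesRegularity.Theses.QuantisedSymmetry
import Summits.NavierStokesRegularity.NavierStokesRegularity.Theses.Blowup
import Summits.NavierStokesRegularity.NavierStokesRegularity.Theorems.QuantisedSymmetryPolyhedralTruncationBridge
import Summits.NavierStokesRegularity.NavierStokesRegularity.Theorems.QuantisedSymmetryPolyhedralDssProfileExistsDominatesBlowupProfile
import Summits.NavierStokesRegularity.NavierStokesRegularity.Cruxes.PolyhedralDssProfileExists.Lines.birth
import Literature.Analysis.FluidPDE.ChaeWolfRemovingDSSHolds

/-!
# Strategist sketch S14-g8 — typed companion of `STRATEGY-CENSUS-s14.md`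
# crux `QuantisedSymmetry.PolyhedralDssProfileExists` (stmt-NavierStokesRegularity-1404)

Second, independent strategy census (family `s`, generation 8). This file records, as
kernel-checked statements over the tree, the facts the census leans on:

* §0 `crux_decides` — the crux ALONE decides the summit negatively: the other two binders of the
  route's deciding theorem `QuantisedSymmetry.closes` are tree theorems
  (`quantisedSymmetry_polyhedralTruncationBridge_proof`, `ClayUniqueness_holds`).
* §1 `w1_of_crux` — the only strictly weaker intermediates are the symmetry-free profile statements of
  other routes (`Blowup.BlowupTypeIDssProfile`, stmt-0155), reached by a tree theorem.
* §1b `crux_of_lqDssOrbitExists` — weakening the Type-I clause is NOT an intermediate: a polyhedral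
  `λ`-DSS classical solution with slices in `C((−∞,0); L^q)`, `q ≥ 3`, and NO decay hypothesis already
  gives the crux, by Chae–Wolf 2017 Thm 1.1 (tree: `chaeWolf2017_dss_typeI_decay_holds`) and the landed
  mild-gauge theorem of the birth line. Proved here (no `sorry`).
* §2 the honest decomposition D-A (`GaussianClassOrbitExists ∧ GaussianOrbitsAreTypeI → crux`, assembly
  proved through the birth composition `Birth.PolyhedralDssProfileExists_of`), with the reason it gives no
  leverage recorded in the docstrings: piece 1 keeps the whole existence content.
* §3 `NoPolyhedralSoliton` — the statement of Lemma R of the census (finite irreducible `G` admits no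
  rotating-frame / RSS reduction), recorded as a `Prop` (the census proves it on paper; not needed by
  any composition here).

Nothing in this file is a registered stub; no `sorry`.
-/

namespace Summit.NavierStokesRegularity.NavierStokesRegularity.Cruxes.PolyhedralDssProfileExists.StrategistS14g8

open MeasureTheory Set Function Filter
open Literature.Analysis.FluidPDE
open _root_.Summit.NavierStokesRegularity.NavierStokesRegularity.Theses.QuantisedSymmetry
  (PolyhedralDssProfileExists PolyhedralTruncationBridge ClayUniqueness ClayUniqueness_holds closes)

local notation "ℝ³" => EuclideanSpace ℝ (Fin 3)

/-! ## §0 The crux alone decides the summit (negatively) -/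

/-- **The crux is summit-deciding on its own.** With `PolyhedralTruncationBridge` (stmt-11331) and
`ClayUniqueness` (stmt-0153) both proved in the tree, the route's deciding theorem `closes` makes
`PolyhedralDssProfileExists → ¬ NavierStokesRegularity` a theorem. [tree: `QuantisedSymmetry.closes`,
`Theorems.quantisedSymmetry_polyhedralTruncationBridge_proof`, `QuantisedSymmetry.ClayUniqueness_holds`] -/
theorem crux_decides (hX : PolyhedralDssProfileExists) : ¬ _root_.NavierStokesRegularity :=
  closes hX
    _root_.Summit.NavierStokesRegularity.NavierStokesRegularity.Theorems.quantisedSymmetry_polyhedralTruncationBridge_proof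
    ClayUniqueness_holds

/-! ## §1 Strictly weaker intermediates -/

/-- **W1.** The crux implies the symmetry-free Type-I DSS profile statement of route `Blowup`
(`BlowupTypeIDssProfile`, stmt-NavierStokesRegularity-0155) — a tree theorem of the `polyhedral_cell` line.
W1 is strictly weaker only in that it forgets `G`; it is itself an open crux of another route and is
decided negatively by exactly the same (absent) Liouville technology. -/
theorem w1_of_crux :
    PolyhedralDssProfileExists →
      _root_.Summit.NavierStokesRegularity.NavierStokesRegularity.Theses.Blowup.BlowupTypeIDssProfile :=
  _root_.Summit.NavierStokesRegularity.NavierStokesRegularity.Theorems.PolyhedralDssProfileExists.PolyhedralCell.stub_dominatesBlowupProfile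

/-! ## §1b Weakening the Type-I clause is not an intermediate -/

/-- The polyhedral rotation-group clause of the crux, factored out. -/
def IsPolyhedralRotationGroup (G : Subgroup (ℝ³ ≃ₗᵢ[ℝ] ℝ³)) : Prop :=
  Finite G ∧ (∀ g ∈ G, LinearMap.det (g.toLinearEquiv : ℝ³ →ₗ[ℝ] ℝ³) = 1) ∧
    (∀ V : Submodule ℝ ℝ³, (∀ g ∈ G, ∀ v ∈ V, g v ∈ V) → V = ⊥ ∨ V = ⊤)

/-- **W-Lq (candidate weaker intermediate): a polyhedral `λ`-DSS classical ancient solution with slices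
in `C((−∞,0); L^q(ℝ³))` — NO Type-I / decay hypothesis, NO mildness hypothesis.** -/
def LqDssOrbitExists (q : ℝ) : Prop :=
  ∃ G : Subgroup (ℝ³ ≃ₗᵢ[ℝ] ℝ³), IsPolyhedralRotationGroup G ∧
    ∃ c : ℝ, 1 < c ∧ ∃ (u : ℝ → ℝ³ → ℝ³) (p : ℝ → ℝ³ → ℝ),
      IsClassicalNSSolutionOn (Iio 0) 1 0 u p ∧
      (∀ t < 0, MemLp (u t) (ENNReal.ofReal q) volume) ∧
      (∀ t₀ < 0, Tendsto (fun t => eLpNorm (u t - u t₀) (ENNReal.ofReal q) volume)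
        (nhdsWithin t₀ (Iio 0)) (nhds 0)) ∧
      IsDiscretelySelfSimilar c u ∧ (∀ g ∈ G, ∀ t x, u t (g x) = g (u t x)) ∧
      ∃ t < 0, ∃ x, u t x ≠ 0

/-- **W-Lq already implies the crux** (`q ≥ 3`): Chae–Wolf 2017, Thm 1.1 (tree theorem
`chaeWolf2017_dss_typeI_decay_holds`) supplies the Type-I bound, the landed birth-line theorem
`Theorems.PolyhedralDssProfileExists.Birth.stub_ancientMild_of_classical_typeI` (p148604) the KNSS mild
gauge, continuity of classical slices the measurability and the upgrade of pointwise to a.e.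
nontriviality. So relaxing the decay/regularity class of the witness produces NO statement strictly
between W-Lq and the crux: the Type-I clause is not where the difficulty sits.
[cite: ChaeWolf2017RemovingDSS Thm 1.1; KNSS2009 §1] -/
theorem crux_of_lqDssOrbitExists {q : ℝ} (hq : 3 ≤ q) (h : LqDssOrbitExists q) :
    PolyhedralDssProfileExists := by
  obtain ⟨G, ⟨hfin, hdet, hirr⟩, c, hc, u, p, hcl, hLq, hcont, hdss, heqv, t₀, ht₀, x₀, hne⟩ := h
  obtain ⟨C, hC⟩ := chaeWolf2017_dss_typeI_decay_holds q hq c hc u p hcl hLq hcont hdss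
  have hanc : IsAncientMildSolution 1 u :=
    _root_.Summit.NavierStokesRegularity.NavierStokesRegularity.Theorems.PolyhedralDssProfileExists.Birth.stub_ancientMild_of_classical_typeI
      u p C hcl hC
  have hcontu : ∀ t < 0, Continuous (u t) := fun t ht =>
    (hcl.contDiff_velocity (S := Iio 0) ht).continuous
  refine ⟨G, hfin, hdet, hirr, c, hc, u, hanc, fun t ht => (hcontu t ht).aestronglyMeasurable, hdss,
    ⟨C, hC⟩, heqv, ?_⟩
  intro hzero
  have hz : u t₀ = 0 := Measure.eq_of_ae_eq (hzero t₀ ht₀) (hcontu t₀ ht₀) continuous_const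
  exact hne (by rw [hz]; rfl)

/-! ## §2 The honest decomposition D-A (typed), and why it gives no leverage -/

/-- Gaussian weight of the backward similarity variables, `ρ(y) = exp(−|y|²/4)`: the linearisation of
the backward Leray system at `U = 0` is `Δ − ½ y·∇ − ½`, self-adjoint in `L²(ρ dy)` with spectrum
`{−½ − k/2 : k ∈ ℕ}` (Hermite), i.e. the origin has no centre directions (no Hopf onset). -/
noncomputable def gaussWeight (y : ℝ³) : ℝ := Real.exp (-(‖y‖ ^ 2) / 4)

/-- **D-A, piece 1 (keeps the whole existence content).** A nontrivial polyhedrally-equivariant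
`S`-periodic classical orbit of the backward Leray system with a UNIFORM GAUSSIAN-ENERGY bound
`∫ |U(s,y)|² ρ(y) dy ≤ E` (no pointwise Type-I profile bound). Why no leverage: `0` is the only
equilibrium in every reasonable class (Tsai 1998 / NRŠ 1996; tree `tsai_selfsimilar_holds`,
`Birth.steadyLerayProfile_eq_zero_of_typeI`), it is linearly stable with no neutral modes, the system
has no parameter to continue in and no monotone/gradient structure (the cubic term of the Gaussian
energy identity is indefinite), so neither Hopf, nor global continuation (Fiedler 1985 index), nor
degree theory (index of `0` is `+1`), nor a variational principle produces the orbit; the Gaussian class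
only removes the far-field bookkeeping, not the existence problem. -/
def GaussianClassOrbitExists : Prop :=
  ∃ G : Subgroup (ℝ³ ≃ₗᵢ[ℝ] ℝ³), IsPolyhedralRotationGroup G ∧
    ∃ S : ℝ, 0 < S ∧ ∃ (U : ℝ → ℝ³ → ℝ³) (P : ℝ → ℝ³ → ℝ),
      IsBackwardLeraySolutionOn univ 1 U P ∧ Function.Periodic U S ∧
      (∃ E : ℝ, ∀ s, ∫⁻ y, ENNReal.ofReal (‖U s y‖ ^ 2 * gaussWeight y) ≤ ENNReal.ofReal E) ∧
      (∀ g ∈ G, ∀ s y, U s (g y) = g (U s y)) ∧ (∃ s y, U s y ≠ 0)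

/-- **D-A, piece 2 (regularity/decay upgrade): Gaussian-class periodic orbits obey the profile Type-I
bound `(1 + |y|)|U| ≤ C₀`.** Plausibly FALSE as typed (the Gaussian class admits polynomially growing
far fields; the known upgrade, Chae–Wolf 2017 Thm 1.1, needs `L^q` slices, `q ≥ 3`) and in any case not
the difficulty. Recorded to make the split's shape explicit. -/
def GaussianOrbitsAreTypeI : Prop :=
  ∀ (G : Subgroup (ℝ³ ≃ₗᵢ[ℝ] ℝ³)), IsPolyhedralRotationGroup G →
    ∀ (S : ℝ), 0 < S → ∀ (U : ℝ → ℝ³ → ℝ³) (P : ℝ → ℝ³ → ℝ),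
      IsBackwardLeraySolutionOn univ 1 U P → Function.Periodic U S →
      (∃ E : ℝ, ∀ s, ∫⁻ y, ENNReal.ofReal (‖U s y‖ ^ 2 * gaussWeight y) ≤ ENNReal.ofReal E) →
      (∀ g ∈ G, ∀ s y, U s (g y) = g (U s y)) →
      ∃ C₀ : ℝ, ∀ s y, (1 + ‖y‖) * ‖U s y‖ ≤ C₀

/-- **Assembly of D-A (proved): piece 1 → piece 2 → crux**, through the birth line's transfer statement
`Birth.PeriodicLerayOrbitExists` and its kernel-checked composition `Birth.PolyhedralDssProfileExists_of`.
The join is modus ponens; the split is honest (k = 2, assembly proved, neither piece is the summit) but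
piece 1 is the crux with its easiest clause removed, so it is NOT filed (`## Decomposition` of the census). -/
theorem crux_of_dA (h₁ : GaussianClassOrbitExists) (h₂ : GaussianOrbitsAreTypeI) :
    PolyhedralDssProfileExists := by
  obtain ⟨G, hG, S, hS, U, P, hsol, hper, hE, heqv, hne⟩ := h₁
  obtain ⟨C₀, hC₀⟩ := h₂ G hG S hS U P hsol hper hE heqv
  obtain ⟨hfin, hdet, hirr⟩ := hG
  exact _root_.Summit.NavierStokesRegularity.NavierStokesRegularity.Cruxes.PolyhedralDssProfileExists.Birth.PolyhedralDssProfileExists_of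
    ⟨G, hfin, hdet, hirr, S, hS, U, P, hsol, hper, ⟨C₀, hC₀⟩, heqv, hne⟩

/-! ## §3 Lemma R (statement): no soliton / rotating-frame reduction in the polyhedral sector -/

/-- **Lemma R of the census (statement only).** A continuous divergence-free field on `ℝ³` that is
equivariant under a finite irreducible rotation group `G` AND under a rotation `R` of infinite order
(the time-`S` map of a rotating frame `y ↦ R y` that does not normalise `G` generates, with `G`, a
dense subgroup of `SO(3)`) is equivariant under all of `SO(3)`, hence radial-vector-valued,
`V(y) = f(|y|) y`, hence zero. Consequence used in `## Transfer`: in the polyhedral sector every RSS /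
rotating-wave ansatz is trivial and RDSS reduces to plain DSS — the witness of the crux is a GENUINE
breather (time-periodic orbit that is not a relative equilibrium), the object for which the sibling
literature (Ricci flow, MCF, semilinear heat) has only NON-existence theorems. Typed here over
`SO(3)`-equivariance directly (the closure argument is paper-side). -/
def NoPolyhedralSoliton : Prop :=
  ∀ (V : ℝ³ → ℝ³), Continuous V →
    (∀ x, HasFDerivAt V (fderiv ℝ V x) x) → (∀ x, LinearMap.trace ℝ ℝ³ (fderiv ℝ V x : ℝ³ →ₗ[ℝ] ℝ³) = 0) →
    (∀ g : ℝ³ ≃ₗᵢ[ℝ] ℝ³, LinearMap.det (g.toLinearEquiv : ℝ³ →ₗ[ℝ] ℝ³) = 1 → ∀ y, V (g y) = g (V y)) →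
    V = 0

end Summit.NavierStokesRegularity.NavierStokesRegularity.Cruxes.PolyhedralDssProfileExists.StrategistS14g8
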